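import Literature.Analysis.FluidPDE.Tao2016AveragedNS.QuadraticCircuits
import HarnessLib

/-!
# Tao 2016, §5.5: the five-mode delay circuit and Theorem 5.3 (delayed abrupt energy transition)

T. Tao, *Finite time blowup for an averaged three-dimensional Navier–Stokes equation*, J. Amer.
Math. Soc. **29** (2016) 601–674 = arXiv:1402.0290, §5.5 "A delayed and abrupt energy
transition" (pp. 28–30 of the arXiv version). [`Tao2016AveragedNS`]

HONEST FRAMING (cell pub-fluidc): part of a low prior, high value-of-information experiment on
Tao's machine paradigm; NOT a claim that NS blows up. This file types a finite-dimensional ODE and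
records one theorem about it as a named fact.

## The circuit (5.5)–(5.6), verbatim (p. 28)
"We will then consider a five-mode circuit `X = (a,b,c,d,ã)` obeying the equations
`∂ₜa = -ε⁻²cd - εab - ε²exp(-K¹⁰)ac`, `∂ₜb = εa² - ε⁻¹K¹⁰c²`,
`∂ₜc = ε²exp(-K¹⁰)a² + ε⁻¹K¹⁰bc`, `∂ₜd = ε⁻²ca - Kdã`, `∂ₜã = Kd²`
and with initial data `a(0) = 1`; `b(0) = c(0) = d(0) = ã(0) = 0`." Here `K ≳ 1` is large and
`0 < ε ≲ 1` small depending on `K` ("e.g. one could choose `ε := 1/exp(exp(CK))`").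
"It should be viewed as a superposition of five quadratic gates:
* A pump of coupling constant `ε` that transfers a small amount of energy from `a` to `b`;
* A pump of coupling constant `ε²exp(-K¹⁰)` that transfers a minute amount of energy from `a` to `c`;
* An amplifier of coupling constant `ε⁻¹K¹⁰` that uses `b` to rapidly amplify `c`;
* A rotor of coupling constant `ε⁻²` that uses `c` to (eventually) rotate energy very rapidly
  between `a` and `d`; and
* A pump of coupling constant `K` that drains energy from `d` to `ã` at a moderately fast pace."
"One should view `a` as the input mode for this circuit, and `ã` as the output mode; in later
sections we will chain an infinite sequence of these circuits (rescaled by an exponentially growing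
parameter) together by identifying the output mode for each circuit with the input mode for the
next."

Here: modes are indexed `a ↦ 0, b ↦ 1, c ↦ 2, d ↦ 3, ã ↦ 4`; `delayCircuit K ε` is (5.5) as
printed, `delayInit` is (5.6); the gate-wiring combinators `pumpOn κ i j`, `amplifierOn κ i j`,
`rotorOn κ i j k` place the binary/ternary gates of `QuadraticCircuits.lean` inside an `m`-mode
circuit, and `delayCircuit_eq_gates` is the KERNEL-CHECKED form of the bullet list above (the
circuit IS the sum of those five gates), whence the cancellation `isCancelling_delayCircuit`
("basically because the system is composed of gates", p. 28) and the energy identity (energy-con)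
`a² + b² + c² + d² + ã² = 1` (`delayCircuit_energy`). The two local energy identities of the proof,
`∂ₜ(b²+c²) = 2εa²b + 2ε²exp(-K¹⁰)a²c` and `∂ₜ(d²+ã²) = 2ε⁻²cad` (p. 29), are
`delayCircuit_bc_energy`, `delayCircuit_out_energy`; `ã` is non-decreasing
(`delayCircuit_output_monotone`, from (ta-eq)).

## Scaling: the level-`n` copies (Remark 6.1, p. 31)
(5.5) is homogeneous quadratic (`delayCircuit_smul`), so if `X` is the unit trajectory then
`t ↦ e • X (Λ e t)` solves `∂ₜY = Λ • delayCircuit K ε Y` with `Y(0) = e • delayInit`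
(`hasDerivAt_delayCircuit_rescale`): level `n` of the cascade of §6 — equations (6.2)–(6.5) with the
interaction and dissipation terms dropped — is the unit circuit run at coupling `Λ = (1+ε₀)^{5n/2}` and
amplitude `e = e_n`, hence fires at time `t_c/(Λ e)` (`rescale_output_window`; compare the lifespan
bound (6.9) `t_n - t_{n-1} ∈ [1/100, 100]·(1+ε₀)^{-5(n-1)/2} e_{n-1}^{-1}` of Proposition 6.3). This is
the dictionary entry "delay ↦ transfer time `T(λ_n) = C λ_n^{-5/2} e_n^{-1}`" of the cell's gadget interface.

## Theorem 5.3 (Delayed abrupt energy transition), verbatim (p. 28)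
"If `K` is sufficiently large, and `ε` sufficiently small depending on `K`, then there exists a time
`t_c = √2 + O(1/√K)` such that `a(t) = 1 + O(K⁻¹⁰)`; `b(t), c(t), d(t), ã(t) = O(K⁻¹⁰)` for
`0 ≤ t ≤ t_c - 1/√K`, and `ã(t) = 1 + O(K⁻¹⁰)`; `a(t), b(t), c(t), d(t) = O(K⁻¹⁰)` for
`t ≥ t_c + 1/√K`." — recorded as the NAMED FACT `DelayedAbruptTransition` (not proved here; the
printed proof, pp. 28–30, is a bootstrap/Grönwall argument on `[0,2]`).

## Typing choices for Theorem 5.3 (see also DIVERGENCE.md of cell pub-fluidc)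
* The implied constants in `O(1/√K)`, `O(K⁻¹⁰)` are absolute (Tao's convention; they do not depend
  on `K`, `ε`): one constant `C`, chosen before `K`. Quantifier shape:
  `∃ C > 0, ∃ K₀ > 0, ∀ K ≥ K₀, ∃ ε₁ > 0, ∀ ε ∈ (0, ε₁], …`.
* "the" solution: (5.5) is a quadratic circuit, hence globally well posed (energy conservation);
  the fact quantifies over every GLOBAL trajectory `X : ℝ → ℝ⁵` with `X(0) = (1,0,0,0,0)`
  (`∀ t, HasDerivAt X (delayCircuit K ε (X t)) t`), which is that unique solution. Existence is not
  asserted by the fact and not needed by its consumers.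
* The second window is `t ≥ t_c + 1/√K` unbounded, as printed. (The printed proof establishes it
  on `[t_c + 1/√K, 2]`; for `t ≥ 2` it follows from monotonicity of `ã`, `ã ≤ 1` and (energy-con),
  at the cost of replacing the absolute constant `C` by `2C + 4C²` — so the verbatim statement is
  the right one to record.)

## Dictionary toward the FLUID COMPUTER gadget interface (cell pub-fluidc, DICTIONARY.md)
input mode `a` ↦ gadget input class at scale `λ`; output mode `ã` ↦ output class (next scale);
delay `t_c ≈ √2` ↦ transfer time `T(λ)` (after rescaling by the level's coupling
`(1+ε₀)^{5n/2}`, §6); transition width `1/√K` ↦ timing tolerance; `1 - O(K⁻¹⁰)` ↦ efficiency `η`;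
the residual `O(K⁻¹⁰)` in `a,b,c,d` ↦ leakage; the implicit stability of the bootstrap under the
`O((1+ε₀)^{-n₀/2})` cross-level errors of §6 ((6.129)–(6.133), in tree:
`TaoCascade.RescaledHypotheses.eq_a_zero` etc.) ↦ robustness radius.

## References
* T. Tao, JAMS 29 (2016) 601–674, arXiv:1402.0290, §5.5: (5.5)/(5.6) [(a-eq)–(ta-eq), (a-init)],
  Theorem 5.3 [(tcable), (able2), (beable)], proof pp. 28–30 [(energy-con), local energy identities].
  [`Tao2016AveragedNS`]
-/

noncomputable section

namespace Literature.Analysis.FluidPDE.Tao2016AveragedNS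

variable {m : ℕ}

/-! ## Wiring the gates of §5.1–5.4 into an `m`-mode circuit -/

/-- A **pump** of coupling `κ` wired from mode `i` (input) to mode `j` (output) inside an `m`-mode
circuit: it contributes `-κ Xᵢ Xⱼ` to `∂ₜXᵢ` and `κ Xᵢ²` to `∂ₜXⱼ`. [cite: Tao2016AveragedNS, §5.1 (pump)] -/
def pumpOn (κ : ℝ) (i j : Fin m) (X : Fin m → ℝ) : Fin m → ℝ :=
  Pi.single i (-(κ * X i * X j)) + Pi.single j (κ * X i ^ 2)

/-- An **amplifier** of coupling `κ` in which mode `i` amplifies mode `j`: `-κ Xⱼ²` to `∂ₜXᵢ`,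
`κ Xᵢ Xⱼ` to `∂ₜXⱼ`. [cite: Tao2016AveragedNS, §5.3 (amp)] -/
def amplifierOn (κ : ℝ) (i j : Fin m) (X : Fin m → ℝ) : Fin m → ℝ :=
  Pi.single i (-(κ * X j ^ 2)) + Pi.single j (κ * X i * X j)

/-- A **rotor** of coupling `κ` in which the driver mode `k` rotates energy between modes `i` and
`j`: `-κ Xⱼ Xₖ` to `∂ₜXᵢ`, `κ Xᵢ Xₖ` to `∂ₜXⱼ`, nothing to `∂ₜXₖ`.
[cite: Tao2016AveragedNS, §5.4 (rotor-def)] -/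
def rotorOn (κ : ℝ) (i j k : Fin m) (X : Fin m → ℝ) : Fin m → ℝ :=
  Pi.single i (-(κ * X j * X k)) + Pi.single j (κ * X i * X k)

/-- `∑ₗ (δᵢ(a) + δⱼ(b))ₗ Xₗ = a Xᵢ + b Xⱼ`. [folklore] -/
theorem sum_single_add_single_mul (i j : Fin m) (a b : ℝ) (X : Fin m → ℝ) :
    ∑ l, (Pi.single i a + Pi.single j b : Fin m → ℝ) l * X l = a * X i + b * X j := by
  simp [Pi.single_apply, Finset.sum_add_distrib, add_mul, ite_mul]

/-- A wired pump cancels. [cite: Tao2016AveragedNS, §5.1] -/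
theorem isCancelling_pumpOn (κ : ℝ) (i j : Fin m) : IsCancelling (pumpOn κ i j) := by
  intro X
  rw [pumpOn, sum_single_add_single_mul]
  ring

/-- A wired amplifier cancels. [cite: Tao2016AveragedNS, §5.3] -/
theorem isCancelling_amplifierOn (κ : ℝ) (i j : Fin m) : IsCancelling (amplifierOn κ i j) := by
  intro X
  rw [amplifierOn, sum_single_add_single_mul]
  ring

/-- A wired rotor cancels. [cite: Tao2016AveragedNS, §5.4] -/
theorem isCancelling_rotorOn (κ : ℝ) (i j k : Fin m) : IsCancelling (rotorOn κ i j k) := by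
  intro X
  rw [rotorOn, sum_single_add_single_mul]
  ring

/-- On two modes the wired pump `0 → 1` is the pump gate of §5.1. [cite: Tao2016AveragedNS, §5.1] -/
theorem pumpOn_two (κ : ℝ) : pumpOn κ (0 : Fin 2) 1 = pumpGate κ := by
  funext X; ext l
  fin_cases l <;> simp [pumpOn, pumpGate]

/-- On two modes the wired amplifier is the amplifier gate of §5.3. [cite: Tao2016AveragedNS, §5.3] -/
theorem amplifierOn_two (κ : ℝ) : amplifierOn κ (0 : Fin 2) 1 = amplifierGate κ := by
  funext X; ext l
  fin_cases l <;> simp [amplifierOn, amplifierGate]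

/-- On three modes the wired rotor (driver `2`) is the rotor gate of §5.4. [cite: Tao2016AveragedNS, §5.4] -/
theorem rotorOn_three (κ : ℝ) : rotorOn κ (0 : Fin 3) 1 2 = rotorGate κ := by
  funext X; ext l
  fin_cases l <;> simp [rotorOn, rotorGate]

/-! ## The five-mode circuit (5.5)–(5.6) -/

/-- **The delay circuit (5.5)** with parameters `K` (large) and `ε` (small), modes
`(a,b,c,d,ã) = (X 0, X 1, X 2, X 3, X 4)`:
`∂ₜa = -ε⁻²cd - εab - ε²e^{-K¹⁰}ac`, `∂ₜb = εa² - ε⁻¹K¹⁰c²`, `∂ₜc = ε²e^{-K¹⁰}a² + ε⁻¹K¹⁰bc`,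
`∂ₜd = ε⁻²ca - Kdã`, `∂ₜã = Kd²`. [cite: Tao2016AveragedNS, §5.5 (5.5)] -/
def delayCircuit (K ε : ℝ) (X : Fin 5 → ℝ) : Fin 5 → ℝ :=
  ![-((ε ^ 2)⁻¹ * X 2 * X 3) - ε * X 0 * X 1 - ε ^ 2 * Real.exp (-K ^ 10) * X 0 * X 2,
    ε * X 0 ^ 2 - ε⁻¹ * K ^ 10 * X 2 ^ 2,
    ε ^ 2 * Real.exp (-K ^ 10) * X 0 ^ 2 + ε⁻¹ * K ^ 10 * X 1 * X 2,
    (ε ^ 2)⁻¹ * X 2 * X 0 - K * X 3 * X 4,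
    K * X 3 ^ 2]

/-- **The initial datum (5.6)**: `a(0) = 1`, `b(0) = c(0) = d(0) = ã(0) = 0`.
[cite: Tao2016AveragedNS, §5.5 (5.6)] -/
def delayInit : Fin 5 → ℝ := ![1, 0, 0, 0, 0]

/-- **(5.5) is the superposition of its five gates** — pump `ε : a → b`, pump `ε²e^{-K¹⁰} : a → c`,
amplifier `ε⁻¹K¹⁰ : b ⇒ c`, rotor `ε⁻² : c ∘ (a,d)`, pump `K : d → ã` — exactly as listed on p. 28.
[cite: Tao2016AveragedNS, §5.5] -/
theorem delayCircuit_eq_gates (K ε : ℝ) :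
    delayCircuit K ε = pumpOn ε 0 1 + pumpOn (ε ^ 2 * Real.exp (-K ^ 10)) 0 2 +
      amplifierOn (ε⁻¹ * K ^ 10) 1 2 + rotorOn ((ε ^ 2)⁻¹) 0 3 2 + pumpOn K 3 4 := by
  funext X; ext l
  fin_cases l <;> simp [delayCircuit, pumpOn, amplifierOn, rotorOn] <;> ring

/-- (5.5) obeys the cancellation (g-cancel) "basically because the system is composed of gates, each
of which individually satisfy this condition". [cite: Tao2016AveragedNS, §5.5] -/
theorem isCancelling_delayCircuit (K ε : ℝ) : IsCancelling (delayCircuit K ε) := by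
  rw [delayCircuit_eq_gates]
  exact ((((isCancelling_pumpOn _ _ _).add (isCancelling_pumpOn _ _ _)).add
    (isCancelling_amplifierOn _ _ _)).add (isCancelling_rotorOn _ _ _ _)).add
    (isCancelling_pumpOn _ _ _)

/-- **(energy-con)**: along the global trajectory from (5.6), `a² + b² + c² + d² + ã² = 1`.
[cite: Tao2016AveragedNS, §5.5 (energy-con)] -/
theorem delayCircuit_energy {K ε : ℝ} {X : ℝ → Fin 5 → ℝ}
    (hX : ∀ t, HasDerivAt X (delayCircuit K ε (X t)) t) (h0 : X 0 = delayInit) (t : ℝ) :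
    energy (X t) = 1 := by
  rw [energy_eq_of_isCancelling (isCancelling_delayCircuit K ε) hX t 0, h0]
  simp [energy, delayInit, Fin.sum_univ_five]

/-- Local energy identity of the `b,c` pair (p. 29): `∂ₜ(b² + c²) = 2εa²b + 2ε²e^{-K¹⁰}a²c` — the
amplifier term cancels, only the two weak pumps feed `(b,c)`. [cite: Tao2016AveragedNS, §5.5 proof] -/
theorem delayCircuit_bc_energy {K ε : ℝ} {X : ℝ → Fin 5 → ℝ} {t : ℝ}
    (hX : HasDerivAt X (delayCircuit K ε (X t)) t) :
    HasDerivAt (fun s => X s 1 ^ 2 + X s 2 ^ 2)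
      (2 * ε * X t 0 ^ 2 * X t 1 + 2 * ε ^ 2 * Real.exp (-K ^ 10) * X t 0 ^ 2 * X t 2) t := by
  refine (((hasDerivAt_pi.1 hX 1).fun_pow 2).fun_add ((hasDerivAt_pi.1 hX 2).fun_pow 2)).congr_deriv ?_
  simp only [show (2 : ℕ) - 1 = 1 from rfl, pow_one, Nat.cast_ofNat, delayCircuit, Fin.isValue,
    Matrix.cons_val_one, Matrix.cons_val_two, Matrix.cons_val_zero, Matrix.head_cons,
    Matrix.tail_cons]
  ring

/-- Local energy identity of the output pair (p. 29): `∂ₜ(d² + ã²) = 2ε⁻²cad` — the drain pump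
cancels, only the rotor feeds `(d,ã)`. [cite: Tao2016AveragedNS, §5.5 proof] -/
theorem delayCircuit_out_energy {K ε : ℝ} {X : ℝ → Fin 5 → ℝ} {t : ℝ}
    (hX : HasDerivAt X (delayCircuit K ε (X t)) t) :
    HasDerivAt (fun s => X s 3 ^ 2 + X s 4 ^ 2)
      (2 * (ε ^ 2)⁻¹ * X t 2 * X t 0 * X t 3) t := by
  refine (((hasDerivAt_pi.1 hX 3).fun_pow 2).fun_add ((hasDerivAt_pi.1 hX 4).fun_pow 2)).congr_deriv ?_
  simp only [show (2 : ℕ) - 1 = 1 from rfl, pow_one, Nat.cast_ofNat, delayCircuit, Fin.isValue,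
    Matrix.cons_val]
  ring

/-- The output `ã` is non-decreasing when `K ≥ 0` (from (ta-eq): `∂ₜã = Kd² ≥ 0`).
[cite: Tao2016AveragedNS, §5.5 proof] -/
theorem delayCircuit_output_monotone {K ε : ℝ} (hK : 0 ≤ K) {X : ℝ → Fin 5 → ℝ}
    (hX : ∀ t, HasDerivAt X (delayCircuit K ε (X t)) t) : Monotone fun t => X t 4 := by
  have hd : ∀ t, HasDerivAt (fun s => X s 4) (K * X t 3 ^ 2) t := fun t => by
    simpa [delayCircuit] using hasDerivAt_pi.1 (hX t) 4
  refine monotone_of_deriv_nonneg (fun t => (hd t).differentiableAt) fun t => ?_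
  rw [(hd t).deriv]
  positivity

/-! ## Scaling: the level-`n` copies of the circuit (Remark 6.1) -/

/-- (5.5) is homogeneous of degree two: `delayCircuit K ε (c • X) = c² • delayCircuit K ε X`.
[cite: Tao2016AveragedNS, §5.5 (5.5)] -/
theorem delayCircuit_smul (K ε c : ℝ) (X : Fin 5 → ℝ) :
    delayCircuit K ε (c • X) = c ^ 2 • delayCircuit K ε X := by
  ext l; fin_cases l <;> simp [delayCircuit, smul_eq_mul] <;> ring

/-- **Rescaled copies** (Remark 6.1: the cascade is "an infinite number of (rescaled) copies of the
quadratic circuit analysed in Theorem 5.3"): if `X` solves the unit circuit then `s ↦ e • X (Λ e s)`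
solves `∂ₜY = Λ • delayCircuit K ε Y` — coupling `Λ` (level `n`: `(1+ε₀)^{5n/2}`), amplitude `e`
(level `n`: `e_n`). [cite: Tao2016AveragedNS, Remark 6.1] -/
theorem hasDerivAt_delayCircuit_rescale {K ε : ℝ} {X : ℝ → Fin 5 → ℝ}
    (hX : ∀ t, HasDerivAt X (delayCircuit K ε (X t)) t) (Λ e t : ℝ) :
    HasDerivAt (fun s => e • X (Λ * e * s)) (Λ • delayCircuit K ε (e • X (Λ * e * t))) t := by
  have h1 : HasDerivAt (fun s => X (Λ * e * s)) ((Λ * e) • delayCircuit K ε (X (Λ * e * t))) t := by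
    have := (hX (Λ * e * t)).scomp t ((hasDerivAt_id t).const_mul (Λ * e))
    simpa [mul_one, Function.comp_def] using this
  have h2 : HasDerivAt (fun s => e • X (Λ * e * s))
      (e • (Λ * e) • delayCircuit K ε (X (Λ * e * t))) t :=
    h1.const_smul e
  convert h2 using 1
  rw [delayCircuit_smul, smul_smul, smul_smul]
  congr 1
  ring

/-- **Delay of a rescaled copy** = `t₁/(Λ e)`: if the unit circuit's output obeys `ã(t) ≥ 1 - δ` for
`t ≥ t₁` (Theorem 5.3: `t₁ = t_c + 1/√K`, `δ = C K⁻¹⁰`), then the copy of coupling `Λ` and amplitude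
`e` has output `≥ e(1 - δ)` for `t ≥ t₁/(Λ e)` — the lifespan law (6.9) `t_n - t_{n-1} ≍
(1+ε₀)^{-5(n-1)/2} e_{n-1}^{-1}` of Proposition 6.3 (vii). [cite: Tao2016AveragedNS, Proposition 6.3 (vii)] -/
theorem rescale_output_window {X : ℝ → Fin 5 → ℝ} {t₁ δ : ℝ} (h : ∀ t, t₁ ≤ t → 1 - δ ≤ X t 4)
    {Λ e : ℝ} (hΛ : 0 < Λ) (he : 0 < e) (t : ℝ) (ht : t₁ / (Λ * e) ≤ t) :
    e * (1 - δ) ≤ (e • X (Λ * e * t)) 4 := by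
  have hΛe : 0 < Λ * e := mul_pos hΛ he
  have : t₁ ≤ Λ * e * t := by rwa [div_le_iff₀ hΛe, mul_comm] at ht
  simpa [Pi.smul_apply, smul_eq_mul] using mul_le_mul_of_nonneg_left (h _ this) he.le

/-! ## Theorem 5.3 as a named fact -/

/-- **Theorem 5.3 (Delayed abrupt energy transition)**, verbatim: "If `K` is sufficiently large,
and `ε` sufficiently small depending on `K`, then there exists a time `t_c = √2 + O(1/√K)` such
that `a(t) = 1 + O(K⁻¹⁰)`; `b(t), c(t), d(t), ã(t) = O(K⁻¹⁰)` for `0 ≤ t ≤ t_c - 1/√K`, and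
`ã(t) = 1 + O(K⁻¹⁰)`; `a(t), b(t), c(t), d(t) = O(K⁻¹⁰)` for `t ≥ t_c + 1/√K`." Typed with one
absolute implied constant `C`, for every global trajectory of (5.5) issuing from (5.6) (= the
unique solution; see the module docstring for the quantifier shape and the unbounded second
window). A NAMED FACT — consumers take `(h : DelayedAbruptTransition)`.
[cite: Tao2016AveragedNS, Theorem 5.3] -/
def DelayedAbruptTransition : Prop :=
  ∃ C : ℝ, 0 < C ∧ ∃ K₀ : ℝ, 0 < K₀ ∧ ∀ K : ℝ, K₀ ≤ K → ∃ ε₁ : ℝ, 0 < ε₁ ∧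
    ∀ ε : ℝ, 0 < ε → ε ≤ ε₁ → ∀ X : ℝ → Fin 5 → ℝ, X 0 = delayInit →
      (∀ t, HasDerivAt X (delayCircuit K ε (X t)) t) →
      ∃ tc : ℝ, |tc - Real.sqrt 2| ≤ C / Real.sqrt K ∧
        (∀ t ∈ Set.Icc 0 (tc - 1 / Real.sqrt K),
          |X t 0 - 1| ≤ C / K ^ 10 ∧ ∀ i : Fin 5, i ≠ 0 → |X t i| ≤ C / K ^ 10) ∧
        (∀ t, tc + 1 / Real.sqrt K ≤ t →
          |X t 4 - 1| ≤ C / K ^ 10 ∧ ∀ i : Fin 5, i ≠ 4 → |X t i| ≤ C / K ^ 10)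

end Literature.Analysis.FluidPDE.Tao2016AveragedNS
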